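import Literature.AnabelianGeometry.AbsoluteAnabelian.GaloisCyclotomeRestriction
import Literature.AnabelianGeometry.AbsoluteAnabelian.AbsTopIII.ReconstructionCor110iiPrime
import HarnessLib

/-!
# [AbsTopIII] Cor. 1.10 (i): the calculus of `μ_{ℚ/ℤ}(β)` / `μ_Ẑ(β)` along injective OPEN homomorphisms —
# representatives, composition, isomorphisms, inner automorphisms

S. Mochizuki, *Topics in Absolute Anabelian Geometry III*, Cor. 1.10 (i) p. 42 (kurims
`paper:url-5493eb38cbb7`): «Here, the asserted "functoriality" is with respect to arbitrary injective open
homomorphisms of profinite groups [cf. also Remark 1.10.1, (iii), below]».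

The tree has `μ_{ℚ/ℤ}(β) : μ_{ℚ/ℤ}(G) ≃ μ_{ℚ/ℤ}(G′)` / `μ_Ẑ(β)` for an injective open `β : G → G′` of compact
Hausdorff groups (`muQZ.mapOfOpenEmbedding`, `muZhat.mapOfOpenEmbedding`, abc-iut-w5-d201,
`GaloisCyclotomeOpenEmbedding.lean` / `GaloisCyclotomeRestriction.lean`: transport to `β(G)` then
open-subgroup invariance).  This PROOF-ONLY file (no definition, no named fact) supplies their calculus,
needed to reduce print's «arbitrary injective open homomorphisms» to the three legs ISOMORPHISM ·
FIELD RESTRICTION · INNER AUTOMORPHISM of `exists_eq_conj_absGaloisRestrict_comp`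
(`OpenInjectionFactorsThroughRestriction.lean`, abc-iut-L4-d3):

* §1 on `μ_{ℚ/ℤ}`: the representative formula `muQZ.mapOfOpenEmbedding_ofRep` (`[u ∈ U] ↦ [β u ∈ β(U)]`,
  the image open subgroup being `osMap (rangeOpenSubgroup β) (imageOpenSubgroup (equivRangeOfInjective β) U)`,
  membership `mem_osMap_imageOpenSubgroup_iff : x ∈ β(U) ↔ ∃ u ∈ U, β u = x`), whence COMPATIBILITY WITH
  COMPOSITION (`muQZ.mapOfOpenEmbedding_comp`), agreement with abc-iut-L4-t1's transport along an
  isomorphism (`muQZ.mapOfOpenEmbedding_coe_continuousMulEquiv`) and, for an INNER automorphism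
  `x ↦ τ⁻¹ x τ`, with the conjugation action of `τ⁻¹` (`muQZ.mapOfOpenEmbedding_of_forall_eq_conj`);
* §2 the same three laws for `μ_Ẑ(β)` (componentwise) and for the INVERSE `μ_Ẑ(β)⁻¹` on the additive
  carriers `MuZhatMod` (the coefficient map of the restriction on cohomology): `…Inv_comp`,
  `…Inv_coe_continuousMulEquiv` (= abc-iut-L4-d1's `MuZhatMod.congrL e⁻¹`), `…Inv_of_forall_eq_conj`
  (= the action of `τ`).

HONEST FRAMING: topological group theory of compact groups; nothing here bears on [IUTchIII] Cor. 3.12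
or takes a side.
-/

noncomputable section
noncomputable section

open CategoryTheory Function

universe u

namespace Literature.AnabelianGeometry.AbsoluteAnabelian

/-! ### §1. Representative formulas; composition, isomorphisms, inner automorphisms on `μ_{ℚ/ℤ}` -/

section MuQZ

variable {G : Type u} [Group G] [TopologicalSpace G] [IsTopologicalGroup G] [CompactSpace G]

variable {G' : Type u} [Group G'] [TopologicalSpace G'] [IsTopologicalGroup G'] [CompactSpace G']
  [T2Space G']
  (f : G →ₜ* G') (hinj : Injective f) (hf : IsOpen (Set.range f))

omit [IsTopologicalGroup G] [IsTopologicalGroup G'] [CompactSpace G'] in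
/-- Membership in the image open subgroup `β(U)` (transport to `β(G)`, then the inclusion `β(G) ⊆ G′`).
[cite: MochizukiAbsTopIII2015, Cor 1.10 (i) p.42] -/
theorem mem_osMap_imageOpenSubgroup_iff (U : OpenSubgroup G) {x : G'} :
    x ∈ osMap (rangeOpenSubgroup f hf) (imageOpenSubgroup (equivRangeOfInjective f hinj hf) U) ↔
      ∃ u ∈ U, f u = x := by
  rw [mem_osMap_iff]
  constructor
  · rintro ⟨hx, hU⟩
    change (equivRangeOfInjective f hinj hf).symm ⟨x, hx⟩ ∈ U at hU
    refine ⟨_, hU, ?_⟩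
    have h := congrArg (fun y : ((rangeOpenSubgroup f hf : OpenSubgroup G') : Subgroup G') => (y : G'))
      ((equivRangeOfInjective f hinj hf).apply_symm_apply ⟨x, hx⟩)
    exact h
  · rintro ⟨u, hu, rfl⟩
    refine ⟨⟨u, rfl⟩, ?_⟩
    change (equivRangeOfInjective f hinj hf).symm ⟨f u, ⟨u, rfl⟩⟩ ∈ U
    have h : (equivRangeOfInjective f hinj hf) u = ⟨f u, ⟨u, rfl⟩⟩ := Subtype.ext rfl
    rw [← h, ContinuousMulEquiv.symm_apply_apply]
    exact hu

omit [IsTopologicalGroup G] [IsTopologicalGroup G'] [CompactSpace G'] in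
/-- `f u ∈ β(U)` for `u ∈ U`. [cite: MochizukiAbsTopIII2015, Cor 1.10 (i) p.42] -/
theorem apply_mem_osMap_imageOpenSubgroup (U : OpenSubgroup G) {u : G} (hu : u ∈ U) :
    f u ∈ osMap (rangeOpenSubgroup f hf) (imageOpenSubgroup (equivRangeOfInjective f hinj hf) U) :=
  (mem_osMap_imageOpenSubgroup_iff f hinj hf U).mpr ⟨u, hu, rfl⟩

/-- **`μ_{ℚ/ℤ}(β)` on representatives**: `[u ∈ U] ↦ [β u ∈ β(U)]`.
[cite: MochizukiAbsTopIII2015, Cor 1.10 (i) p.42] -/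
theorem muQZ.mapOfOpenEmbedding_ofRep (U : OpenSubgroup G) (u : G) (hu : u ∈ U) (ht) :
    ∃ ht', muQZ.mapOfOpenEmbedding f hinj hf (muQZ.ofRep U u hu ht) =
      muQZ.ofRep (osMap (rangeOpenSubgroup f hf) (imageOpenSubgroup (equivRangeOfInjective f hinj hf) U)) (f u) (apply_mem_osMap_imageOpenSubgroup f hinj hf U hu) ht' := by
  have hmem : (equivRangeOfInjective f hinj hf) u ∈
      imageOpenSubgroup (equivRangeOfInjective f hinj hf) U :=
    apply_mem_imageOpenSubgroup _ U hu
  have ht₁ : (QuotientGroup.mk (⟨(equivRangeOfInjective f hinj hf) u, hmem⟩ :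
      ((imageOpenSubgroup (equivRangeOfInjective f hinj hf) U :
        OpenSubgroup ((rangeOpenSubgroup f hf : OpenSubgroup G') : Subgroup G')) :
          Subgroup ((rangeOpenSubgroup f hf : OpenSubgroup G') : Subgroup G'))) :
        TopologicalAbelianization _) ∈ abelianizationTorsion _ := by
    rw [← coe_torsionTransport_mk (equivRangeOfInjective f hinj hf) U ⟨u, hu⟩ ht]
    exact (torsionTransport _ U _).2
  refine ⟨(torsionCongr (topAbelianizationCongr (osEquiv (rangeOpenSubgroup f hf)
    (imageOpenSubgroup (equivRangeOfInjective f hinj hf) U))) ⟨_, ht₁⟩).2, ?_⟩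
  change muQZ.restrictOpenEquiv _ (muQZ.congr (equivRangeOfInjective f hinj hf) (muQZ.ofRep U u hu ht)) = _
  rw [muQZ.restrictOpenEquiv_apply]
  change muQZ.restrictOpen _ (muQZ.map (equivRangeOfInjective f hinj hf) (muQZ.ofRep U u hu ht)) = _
  rw [muQZ.map_ofRep, muQZ.restrictOpen_ofRep]
  rfl

/-- `μ_{ℚ/ℤ}(β)` on representatives, equational form usable under `ofRep_congr`.
[cite: MochizukiAbsTopIII2015, Cor 1.10 (i) p.42] -/
theorem muQZ.mapOfOpenEmbedding_ofRep_eq (U : OpenSubgroup G) (u : G) (hu : u ∈ U) (ht)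
    {V : OpenSubgroup G'}
    (hV : osMap (rangeOpenSubgroup f hf) (imageOpenSubgroup (equivRangeOfInjective f hinj hf) U) = V) {v : G'} (hv : f u = v) (hv' : v ∈ V) (ht') :
    muQZ.mapOfOpenEmbedding f hinj hf (muQZ.ofRep U u hu ht) = muQZ.ofRep V v hv' ht' := by
  obtain ⟨ht₀, h⟩ := muQZ.mapOfOpenEmbedding_ofRep f hinj hf U u hu ht
  rw [h]
  exact muQZ.ofRep_congr hV hv

variable {G'' : Type u} [Group G''] [TopologicalSpace G''] [IsTopologicalGroup G''] [CompactSpace G'']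
  [T2Space G'']

omit [IsTopologicalGroup G] [CompactSpace G] [IsTopologicalGroup G'] [T2Space G'] [IsTopologicalGroup G'']
  [CompactSpace G''] in
/-- The composite of two injective open homomorphisms has open range (an injective continuous
homomorphism with open range from a compact to a Hausdorff group is an open map).
[cite: MochizukiAbsTopIII2015, Cor 1.10 (i) p.42] -/
theorem isOpen_range_comp_of_isOpen_range {f : G →ₜ* G'} (hf : IsOpen (Set.range f))
    (g : G' →ₜ* G'') (hginj : Injective g) (hg : IsOpen (Set.range g)) :
    IsOpen (Set.range (g.comp f)) := by
  -- `g` is a closed embedding (compact → Hausdorff, injective) with open range, hence an open embedding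
  have hce : Topology.IsClosedEmbedding g := Continuous.isClosedEmbedding g.continuous hginj
  have hoe : Topology.IsOpenEmbedding g := ⟨hce.toIsEmbedding, hg⟩
  have : Set.range (g.comp f) = g '' Set.range f := by
    ext x; constructor
    · rintro ⟨a, rfl⟩; exact ⟨f a, ⟨a, rfl⟩, rfl⟩
    · rintro ⟨_, ⟨a, rfl⟩, rfl⟩; exact ⟨a, rfl⟩
  rw [this]
  exact hoe.isOpenMap _ hf

/-- **`μ_{ℚ/ℤ}` of a composite of injective open homomorphisms is the composite.**
[cite: MochizukiAbsTopIII2015, Cor 1.10 (i) p.42] -/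
theorem muQZ.mapOfOpenEmbedding_comp (g : G' →ₜ* G'') (hginj : Injective g) (hg : IsOpen (Set.range g))
    (hinj' : Injective (g.comp f)) (hf' : IsOpen (Set.range (g.comp f))) (z : muQZ G) :
    muQZ.mapOfOpenEmbedding (g.comp f) hinj' hf' z =
      muQZ.mapOfOpenEmbedding g hginj hg (muQZ.mapOfOpenEmbedding f hinj hf z) := by
  obtain ⟨U, u, hu, ht, rfl⟩ := muQZ.exists_ofRep z
  obtain ⟨ht₁, h₁⟩ := muQZ.mapOfOpenEmbedding_ofRep f hinj hf U u hu ht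
  obtain ⟨ht₂, h₂⟩ := muQZ.mapOfOpenEmbedding_ofRep g hginj hg
    (osMap (rangeOpenSubgroup f hf) (imageOpenSubgroup (equivRangeOfInjective f hinj hf) U)) (f u)
    (apply_mem_osMap_imageOpenSubgroup f hinj hf U hu) ht₁
  rw [h₁, h₂]
  refine muQZ.mapOfOpenEmbedding_ofRep_eq (g.comp f) hinj' hf' U u hu ht (OpenSubgroup.ext fun x => ?_) rfl _ _
  rw [mem_osMap_imageOpenSubgroup_iff, mem_osMap_imageOpenSubgroup_iff]
  constructor
  · rintro ⟨a, ha, rfl⟩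
    exact ⟨f a, apply_mem_osMap_imageOpenSubgroup f hinj hf U ha, rfl⟩
  · rintro ⟨b, hb, rfl⟩
    obtain ⟨a, ha, rfl⟩ := (mem_osMap_imageOpenSubgroup_iff f hinj hf U).mp hb
    exact ⟨a, ha, rfl⟩

omit [T2Space G'] in
/-- **Along an ISOMORPHISM, `μ_{ℚ/ℤ}(β)` is the transport `muQZ.map`** (abc-iut-L4-t1).
[cite: MochizukiAbsTopIII2015, Cor 1.10 (i) p.42] -/
theorem muQZ.mapOfOpenEmbedding_coe_continuousMulEquiv [T2Space G'] (e : G ≃ₜ* G')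
    (hinj' : Injective (e : G →ₜ* G')) (hf' : IsOpen (Set.range (e : G →ₜ* G'))) (z : muQZ G) :
    muQZ.mapOfOpenEmbedding (e : G →ₜ* G') hinj' hf' z = muQZ.map e z := by
  obtain ⟨U, u, hu, ht, rfl⟩ := muQZ.exists_ofRep z
  rw [muQZ.map_ofRep]
  refine muQZ.mapOfOpenEmbedding_ofRep_eq (e : G →ₜ* G') hinj' hf' U u hu ht
    (OpenSubgroup.ext fun x => ?_) rfl _ _
  rw [mem_osMap_imageOpenSubgroup_iff]
  change (∃ a ∈ U, e a = x) ↔ e.symm x ∈ U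
  constructor
  · rintro ⟨a, ha, rfl⟩
    rwa [e.symm_apply_apply]
  · intro hx
    exact ⟨e.symm x, hx, e.apply_symm_apply x⟩

/-- **Along an INNER automorphism `x ↦ τ⁻¹ x τ`, `μ_{ℚ/ℤ}(β)` is the conjugation action of `τ⁻¹`.**
[cite: MochizukiAbsTopIII2015, Cor 1.10 (i) p.42] -/
theorem muQZ.mapOfOpenEmbedding_of_forall_eq_conj [T2Space G] (τ : G) (φ : G →ₜ* G)
    (hφ : ∀ x, φ x = τ⁻¹ * x * τ) (hinj' : Injective φ) (hf' : IsOpen (Set.range φ)) (z : muQZ G) :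
    muQZ.mapOfOpenEmbedding φ hinj' hf' z = τ⁻¹ • z := by
  obtain ⟨U, u, hu, ht, rfl⟩ := muQZ.exists_ofRep z
  rw [muQZ.smul_ofRep]
  refine muQZ.mapOfOpenEmbedding_ofRep_eq φ hinj' hf' U u hu ht (OpenSubgroup.ext fun x => ?_)
    (by rw [hφ, conjContinuousMulEquiv_apply, inv_inv]) _ _
  rw [mem_osMap_imageOpenSubgroup_iff]
  change (∃ a ∈ U, φ a = x) ↔ (conjContinuousMulEquiv τ⁻¹).symm x ∈ U
  have hs : (conjContinuousMulEquiv τ⁻¹).symm x = τ * x * τ⁻¹ := by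
    apply (conjContinuousMulEquiv τ⁻¹).injective
    rw [ContinuousMulEquiv.apply_symm_apply, conjContinuousMulEquiv_apply, inv_inv]
    group
  rw [hs]
  constructor
  · rintro ⟨a, ha, rfl⟩
    rw [hφ]
    have : τ * (τ⁻¹ * a * τ) * τ⁻¹ = a := by group
    rwa [this]
  · intro hx
    refine ⟨τ * x * τ⁻¹, hx, ?_⟩
    rw [hφ]; group

end MuQZ

/-! ### §2. The same laws for `μ_Ẑ(β)` and for the coefficient morphism `μ_Ẑ(β)⁻¹` on `MuZhatMod` -/

section MuZhat

variable {G : Type u} [Group G] [TopologicalSpace G] [IsTopologicalGroup G] [CompactSpace G]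
  {G' : Type u} [Group G'] [TopologicalSpace G'] [IsTopologicalGroup G'] [CompactSpace G'] [T2Space G']
  {G'' : Type u} [Group G''] [TopologicalSpace G''] [IsTopologicalGroup G''] [CompactSpace G'']
  [T2Space G'']
  (f : G →ₜ* G') (hinj : Injective f) (hf : IsOpen (Set.range f))

/-- **`μ_Ẑ` of a composite of injective open homomorphisms is the composite.**
[cite: MochizukiAbsTopIII2015, Cor 1.10 (i) p.42] -/
theorem muZhat.mapOfOpenEmbedding_comp (g : G' →ₜ* G'') (hginj : Injective g) (hg : IsOpen (Set.range g))
    (hinj' : Injective (g.comp f)) (hf' : IsOpen (Set.range (g.comp f))) (ζ : muZhat G) :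
    muZhat.mapOfOpenEmbedding (g.comp f) hinj' hf' ζ =
      muZhat.mapOfOpenEmbedding g hginj hg (muZhat.mapOfOpenEmbedding f hinj hf ζ) := by
  refine Subtype.ext (funext fun n => ?_)
  rw [muZhat.coe_mapOfOpenEmbedding_apply, muZhat.coe_mapOfOpenEmbedding_apply,
    muZhat.coe_mapOfOpenEmbedding_apply, toAdd_ofAdd, muQZ.mapOfOpenEmbedding_comp f hinj hf g hginj hg]

omit [T2Space G'] in
/-- **Along an isomorphism, `μ_Ẑ(β)` is the transport `muZhat.map`.**
[cite: MochizukiAbsTopIII2015, Cor 1.10 (i) p.42] -/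
theorem muZhat.mapOfOpenEmbedding_coe_continuousMulEquiv [T2Space G'] (e : G ≃ₜ* G')
    (hinj' : Injective (e : G →ₜ* G')) (hf' : IsOpen (Set.range (e : G →ₜ* G'))) (ζ : muZhat G) :
    muZhat.mapOfOpenEmbedding (e : G →ₜ* G') hinj' hf' ζ = muZhat.map e ζ := by
  refine Subtype.ext (funext fun n => ?_)
  rw [muZhat.coe_mapOfOpenEmbedding_apply, muZhat.map_apply_coe,
    muQZ.mapOfOpenEmbedding_coe_continuousMulEquiv]

/-- **Along an inner automorphism `x ↦ τ⁻¹ x τ`, `μ_Ẑ(β)` is the action of `τ⁻¹`.**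
[cite: MochizukiAbsTopIII2015, Cor 1.10 (i) p.42] -/
theorem muZhat.mapOfOpenEmbedding_of_forall_eq_conj [T2Space G] (τ : G) (φ : G →ₜ* G)
    (hφ : ∀ x, φ x = τ⁻¹ * x * τ) (hinj' : Injective φ) (hf' : IsOpen (Set.range φ)) (ζ : muZhat G) :
    muZhat.mapOfOpenEmbedding φ hinj' hf' ζ = τ⁻¹ • ζ := by
  refine Subtype.ext (funext fun n => ?_)
  rw [muZhat.coe_mapOfOpenEmbedding_apply, muZhat.coe_smul_apply,
    muQZ.mapOfOpenEmbedding_of_forall_eq_conj τ φ hφ]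
  apply Multiplicative.toAdd.injective
  rw [toAdd_ofAdd, muQZ.toAdd_smul]

/-- Formula for the coefficient map `μ_Ẑ(β)⁻¹` on `MuZhatMod`. [cite: MochizukiAbsTopIII2015, Cor 1.10 (i) p.42] -/
theorem MuZhatMod.toMuZhat_mapOfOpenEmbeddingInv (m : MuZhatMod G') :
    (MuZhatMod.mapOfOpenEmbeddingInv f hinj hf m).toMuZhat =
      (muZhat.mapOfOpenEmbedding f hinj hf).symm m.toMuZhat := rfl

/-- **`μ_Ẑ(g ∘ f)⁻¹ = μ_Ẑ(f)⁻¹ ∘ μ_Ẑ(g)⁻¹`** on `MuZhatMod`. [cite: MochizukiAbsTopIII2015, Cor 1.10 (i) p.42] -/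
theorem MuZhatMod.mapOfOpenEmbeddingInv_comp (g : G' →ₜ* G'') (hginj : Injective g)
    (hg : IsOpen (Set.range g)) (hinj' : Injective (g.comp f)) (hf' : IsOpen (Set.range (g.comp f)))
    (m : MuZhatMod G'') :
    MuZhatMod.mapOfOpenEmbeddingInv (g.comp f) hinj' hf' m =
      MuZhatMod.mapOfOpenEmbeddingInv f hinj hf (MuZhatMod.mapOfOpenEmbeddingInv g hginj hg m) := by
  apply (show Injective (MuZhatMod.toMuZhat (G := G)) from fun _ _ h => h)
  rw [MuZhatMod.toMuZhat_mapOfOpenEmbeddingInv, MuZhatMod.toMuZhat_mapOfOpenEmbeddingInv,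
    MuZhatMod.toMuZhat_mapOfOpenEmbeddingInv]
  apply (muZhat.mapOfOpenEmbedding (g.comp f) hinj' hf').injective
  rw [MulEquiv.apply_symm_apply, muZhat.mapOfOpenEmbedding_comp f hinj hf g hginj hg hinj' hf',
    MulEquiv.apply_symm_apply, MulEquiv.apply_symm_apply]

omit [T2Space G'] in
/-- **Along an isomorphism `e`, `μ_Ẑ(e)⁻¹` on `MuZhatMod` is abc-iut-L4-d1's `MuZhatMod.congrL e⁻¹`.**
[cite: MochizukiAbsTopIII2015, Cor 1.10 (i) p.42] -/
theorem MuZhatMod.mapOfOpenEmbeddingInv_coe_continuousMulEquiv [T2Space G'] (e : G ≃ₜ* G')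
    (hinj' : Injective (e : G →ₜ* G')) (hf' : IsOpen (Set.range (e : G →ₜ* G'))) (m : MuZhatMod G') :
    MuZhatMod.mapOfOpenEmbeddingInv (e : G →ₜ* G') hinj' hf' m = MuZhatMod.congrL e.symm m := by
  apply (show Injective (MuZhatMod.toMuZhat (G := G)) from fun _ _ h => h)
  rw [MuZhatMod.toMuZhat_mapOfOpenEmbeddingInv, MuZhatMod.toMuZhat_congrL]
  apply (muZhat.mapOfOpenEmbedding (e : G →ₜ* G') hinj' hf').injective
  rw [MulEquiv.apply_symm_apply, muZhat.mapOfOpenEmbedding_coe_continuousMulEquiv, ← muZhat.coe_congr,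
    ← muZhat.coe_congr]
  change m.toMuZhat = muZhat.congr e ((muZhat.congr e).symm m.toMuZhat)
  rw [MulEquiv.apply_symm_apply]

/-- **Along an inner automorphism `x ↦ τ⁻¹ x τ`, `μ_Ẑ(β)⁻¹` on `MuZhatMod` is the action of `τ`.**
[cite: MochizukiAbsTopIII2015, Cor 1.10 (i) p.42] -/
theorem MuZhatMod.mapOfOpenEmbeddingInv_of_forall_eq_conj [T2Space G] (τ : G) (φ : G →ₜ* G)
    (hφ : ∀ x, φ x = τ⁻¹ * x * τ) (hinj' : Injective φ) (hf' : IsOpen (Set.range φ)) (m : MuZhatMod G) :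
    MuZhatMod.mapOfOpenEmbeddingInv φ hinj' hf' m = MuZhatMod.act G τ m := by
  apply (show Injective (MuZhatMod.toMuZhat (G := G)) from fun _ _ h => h)
  rw [MuZhatMod.toMuZhat_mapOfOpenEmbeddingInv, MuZhatMod.toMuZhat_act]
  apply (muZhat.mapOfOpenEmbedding φ hinj' hf').injective
  rw [MulEquiv.apply_symm_apply, muZhat.mapOfOpenEmbedding_of_forall_eq_conj τ φ hφ, smul_smul,
    inv_mul_cancel, one_smul]

end MuZhat

end Literature.AnabelianGeometry.AbsoluteAnabelian
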